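import Literature.NumberTheory.EllipticCurves.PAdicBSD
import Literature.NumberTheory.EllipticCurves.ModPReducibilityProofs
import HarnessLib

/-!
# `L_p(E, T) ∈ Λ` for `E[p]` irreducible: the named fact `padicLFunction_mem_iwasawaAlgebra` holds
# (BSD family, bsd.S23; discharge)

`Proofs` companion (theorems only) of `Literature.NumberTheory.EllipticCurves.PAdicBSD`, which
cannot import the proof files of its prelude `PAdicLFunction` (it is itself imported by the
Iwasawa-theoretic statement files). It discharges the named fact
`Literature.NumberTheory.EllipticCurves.padicLFunction_mem_iwasawaAlgebra` (**bsd.S23**, integrality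
of the Mazur–Swinnerton-Dyer / Mazur–Tate–Teitelbaum `p`-adic `L`-function): for `E = W / ℚ` an
elliptic curve in globally minimal form, `p` an *odd* prime of good *ordinary* reduction, `f` the
newform of `E` and `α = unitRoot W p` the unit root of `X² - a_p X + p`, if the mod-`p` Galois
representation `E[p]` is irreducible then `L_p(E, T) = padicLFunction f α ∈ ℚ_p⟦T⟧` lies in the
Iwasawa algebra: `L_p(E, T) = ι G` for some `G ∈ Λ = ℤ_p⟦T⟧`, `ι = iwasawaToPowerSeries p` the
coefficientwise inclusion `ℤ_p⟦T⟧ ↪ ℚ_p⟦T⟧` (Mazur–Tate–Teitelbaum 1986, §I.12: `L_p` lives in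
`Λ ⊗ ℚ_p`, and in `Λ` for a `ℤ_p`-valued measure; Greenberg–Vatsal 2000, Prop. 3.7: "Assume
either that `E` is optimal, or that `E[p]` is irreducible … Then `L(E/ℚ, χ, T) ∈ Λ`", here
`χ = 1`; Stevens, Invent. Math. 98 (1989), Thm. 4.6 / Cor. 4.7 (p. 93): integrality up to the Manin
constant `c(π)` of an `X₁(N)`-parametrisation `π`, unconditional integrality being Stevens'
Conjecture IV ⇐ Conjecture I (1.3) — NOT "Thm. 1.3", which is a conjecture in that paper).

Nothing new is proved here beyond lifting coefficients; the file exists because `PAdicBSD` must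
stay light. The architecture of the proof now in the tree:

1. `padicLFunction_mem_integral_holds` (`ModPReducibilityProofs`) — every coefficient
   `c_k = padicLCoeff f α k` of `L_p(E, T)` has `‖c_k‖_p ≤ 1` — assembled from
   `padicLFunction_mem_integral_of` (`PAdicLFunctionIntegralityProofs`: Manin's relation
   `{∞, a/pⁿ} ≡ {∞, 0} (mod Λ_f)` for `p ∤ N`, the Eisenstein multiple `(a_ℓ - ℓ - 1){∞, 0} ∈ Λ_f`
   from the Hecke action (Mazur–Tate–Teitelbaum (4.2)), whence `p`-integrality of `[a/pⁿ]⁺_f` as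
   soon as `p ∤ a_ℓ - ℓ - 1` for one good `ℓ ≠ p`; the `ℤ_p`-valued measure `μ_{f,α}`, the
   `p`-integral Riemann sums, their convergence, and closedness of the unit ball of `ℚ_p`) and
   `not_irreducible_of_frobeniusTrace_congr_holds` (such an `ℓ` exists when `E[p]` is
   irreducible: Frobenius' density theorem, reduction of torsion, the invariant line of a plane
   representation all of whose elements have eigenvalue `1`).
2. Here: `G = ∑_k ⟨c_k, ‖c_k‖ ≤ 1⟩ T^k ∈ ℤ_p⟦T⟧` maps to `L_p(E, T)` under
   `PowerSeries.map (algebraMap ℤ_[p] ℚ_[p])` (`padicLFunction_mem_iwasawaAlgebra_holds`), and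
   conversely `L_p = ι G` forces `‖c_k‖ ≤ 1` (`padicLFunction_mem_iwasawaAlgebra_iff_mem_integral`:
   the two named facts are the same statement), so that `G` is unique
   (`iwasawaToPowerSeries_injective`).

As a corollary `L_p(E, T) ∈ Λ ⊗ ℚ_p` (`MemIwasawaRat`, exponent `n = 0`) under the same
hypotheses (`memIwasawaRat_padicLFunction_of_irreducible`); the unconditional bsd.S23 fact
`memIwasawaRat_padicLFunction` (no parity or irreducibility hypothesis; bounded denominators of
the `[a/pⁿ]⁺_f`) is *not* discharged here.

## References

* B. Mazur, J. Tate, J. Teitelbaum, *On `p`-adic analogues of the conjectures of Birch and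
  Swinnerton-Dyer*, Invent. Math. 84 (1986), 1–48, §I.12–I.13. [MazurTateTeitelbaum1986]
* R. Greenberg, V. Vatsal, *On the Iwasawa invariants of elliptic curves*, Invent. Math. 142
  (2000), 17–63, Prop. 3.7. [GreenbergVatsal2000]
* G. Stevens, *Stickelberger elements and modular parametrizations of elliptic curves*, Invent.
  Math. 98 (1989), 75–106, Thm. 1.3.

## Design

Theorems only, `namespace Literature.NumberTheory.EllipticCurves`; axioms of every theorem:
`propext`, `Classical.choice`, `Quot.sound`.
-/

noncomputable section

open scoped MatrixGroups ModularForm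

open CongruenceSubgroup Literature.NumberTheory.EllipticCurves.ModularForms

namespace Literature.NumberTheory.EllipticCurves

variable {W : WeierstrassCurve ℚ} [W.IsElliptic] [W.IsGloballyMinimal] {p : ℕ} [Fact p.Prime]
  {N : ℕ} [NeZero N] {f : CuspForm (Gamma0 N) 2}

/-- A power series over `ℚ_p` all of whose coefficients have norm `≤ 1` is the image of a power
series over `ℤ_p` under the coefficientwise inclusion `ι = PowerSeries.map (algebraMap ℤ_[p] ℚ_[p])`
(`ℤ_p` is the closed unit ball of `ℚ_p`), and conversely. [folklore] -/
theorem exists_iwasawaToPowerSeries_eq_iff_norm_coeff_le_one (L : PowerSeries ℚ_[p]) :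
    (∃ G : IwasawaAlgebra p, iwasawaToPowerSeries p G = L) ↔
      ∀ k : ℕ, ‖PowerSeries.coeff k L‖ ≤ 1 := by
  constructor
  · rintro ⟨G, rfl⟩ k
    rw [PowerSeries.coeff_map]
    exact (PowerSeries.coeff k G).norm_le_one
  · intro h
    refine ⟨PowerSeries.mk fun k ↦ ⟨PowerSeries.coeff k L, h k⟩, ?_⟩
    ext k
    simp [PowerSeries.coeff_map]

omit [W.IsElliptic] in
/-- **The two bsd.S23 integrality facts are one statement**: `L_p(E, T) ∈ Λ`
(`padicLFunction_mem_iwasawaAlgebra`: `L_p(E, T) = ι G`, `G ∈ ℤ_p⟦T⟧`) iff every coefficient of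
`L_p(E, T)` lies in `ℤ_p` (`padicLFunction_mem_integral`: `‖padicLCoeff f α k‖ ≤ 1` for all `k`),
under the common hypotheses `p ≠ 2`, `p` good ordinary, `f` the newform of `W`, `E[p]` irreducible
(Mazur–Tate–Teitelbaum 1986, §I.12: `Λ ↪ Λ ⊗ ℚ_p ⊆ ℚ_p⟦T⟧` coefficientwise).
[cite: MazurTateTeitelbaum1986, §I.12] -/
theorem padicLFunction_mem_iwasawaAlgebra_iff_mem_integral :
    padicLFunction_mem_iwasawaAlgebra (W := W) (p := p) (f := f) ↔
      padicLFunction_mem_integral (f := f) (p := p) (W := W) := by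
  constructor
  · intro h hp hord hf hirr k
    have h' := (exists_iwasawaToPowerSeries_eq_iff_norm_coeff_le_one _).mp (h hp hord hf hirr) k
    rwa [coeff_padicLFunction] at h'
  · intro h hp hord hf hirr
    refine (exists_iwasawaToPowerSeries_eq_iff_norm_coeff_le_one _).mpr fun k ↦ ?_
    rw [coeff_padicLFunction]
    exact h hp hord hf hirr k

/-- **bsd.S23 — `L_p(E, T) ∈ Λ` for `E[p]` irreducible; discharge of the named fact
`padicLFunction_mem_iwasawaAlgebra`** (Mazur–Tate–Teitelbaum 1986, §I.12; Greenberg–Vatsal 2000,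
Prop. 3.7: "Assume … that `E[p]` is irreducible … Then `L(E/ℚ, χ, T) ∈ Λ`", `χ = 1`; Stevens
1989, Thm. 4.6 / Cor. 4.7, p. 93 — integrality up to the Manin constant of an
`X₁(N)`-parametrisation). For `E = W / ℚ` elliptic and globally minimal, `p` an odd good
ordinary prime, `f` the newform of `E` and `E[p]` irreducible, there is `G ∈ Λ = ℤ_p⟦T⟧` with
`ι G = L_p(E, T) = padicLFunction f (unitRoot W p)`. Proof: the coefficientwise integrality
`padicLFunction_mem_integral_holds` (`ModPReducibilityProofs`, unconditional) and
`padicLFunction_mem_iwasawaAlgebra_iff_mem_integral`. [cite: MazurTateTeitelbaum1986, §I.12] -/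
theorem padicLFunction_mem_iwasawaAlgebra_holds :
    padicLFunction_mem_iwasawaAlgebra (W := W) (p := p) (f := f) :=
  padicLFunction_mem_iwasawaAlgebra_iff_mem_integral.mpr padicLFunction_mem_integral_holds

/-- The same statement with its hypotheses explicit: for `p ≠ 2` good ordinary, `f` the newform
of `W` and `E[p]` irreducible, `L_p(E, T) = ι G` for some `G ∈ ℤ_p⟦T⟧`
(Greenberg–Vatsal 2000, Prop. 3.7). [cite: GreenbergVatsal2000, Prop. 3.7] -/
theorem exists_iwasawaToPowerSeries_eq_padicLFunction (hp : p ≠ 2) (hord : IsOrdinaryAt W p)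
    (hf : IsNewformOf W f) (hirr : W.HasIrreducibleModPGaloisRep p) :
    ∃ G : IwasawaAlgebra p, iwasawaToPowerSeries p G = padicLFunction f (unitRoot W p : ℚ_[p]) :=
  padicLFunction_mem_iwasawaAlgebra_holds hp hord hf hirr

/-- The integral `p`-adic `L`-function is unique: if `ι G = L_p(E, T) = ι G'` then `G = G'`
(`ι : Λ ↪ ℚ_p⟦T⟧` is injective, `iwasawaToPowerSeries_injective`; Mazur–Tate–Teitelbaum 1986,
§I.12). [cite: MazurTateTeitelbaum1986, §I.12] -/
theorem existsUnique_iwasawaToPowerSeries_eq_padicLFunction (hp : p ≠ 2)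
    (hord : IsOrdinaryAt W p) (hf : IsNewformOf W f) (hirr : W.HasIrreducibleModPGaloisRep p) :
    ∃! G : IwasawaAlgebra p,
      iwasawaToPowerSeries p G = padicLFunction f (unitRoot W p : ℚ_[p]) := by
  obtain ⟨G, hG⟩ := exists_iwasawaToPowerSeries_eq_padicLFunction hp hord hf hirr
  exact ⟨G, hG, fun G' hG' ↦ iwasawaToPowerSeries_injective p (hG'.trans hG.symm)⟩

/-- Corollary: under the same hypotheses `L_p(E, T) ∈ Λ ⊗ ℚ_p = Λ[1/p]` (`MemIwasawaRat`, with
exponent `n = 0`; Mazur–Tate–Teitelbaum 1986, §I.12). This is the case `p ≠ 2`, `E[p]`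
irreducible of the bsd.S23 fact `memIwasawaRat_padicLFunction`, which itself carries neither
hypothesis and is not discharged here. [cite: MazurTateTeitelbaum1986, §I.12] -/
theorem memIwasawaRat_padicLFunction_of_irreducible (hp : p ≠ 2) (hord : IsOrdinaryAt W p)
    (hf : IsNewformOf W f) (hirr : W.HasIrreducibleModPGaloisRep p) :
    MemIwasawaRat p (padicLFunction f (unitRoot W p : ℚ_[p])) := by
  obtain ⟨G, hG⟩ := exists_iwasawaToPowerSeries_eq_padicLFunction hp hord hf hirr
  rw [← hG]
  exact memIwasawaRat_iwasawaToPowerSeries p G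

end Literature.NumberTheory.EllipticCurves

end
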